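import Summits.AtomisticToContinuum.HydrodynamicLimit.Theorems.AntiMazurCoboundariesCellForecastPressureDecayKinematicAssemblyIsolatedPair
import HarnessLib

/-!
# S2d · kinematic assembly, piece 2 (registered form): a fresh pair collides by the two-body kinematics
# (registered sub-goal `stub_kinematicAssembly_freshPair` of stub `stub_kinematicAssembly`, crux line
# `enskog-compensator-martingale`, crux `CellForecastPressureDecay`, stmt-AtomisticToContinuum-13915)

The registered form, for the whole-cell Euclidean flow of the line's objects (`a = 0`, good initial datum), of the
fresh-pair kinematics `fresh_collision` / `mem_cylinder_of_fresh_collision` (file `…KinematicAssemblyIsolatedPair`),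
completed by the identification of the collision time with the FIRST hitting time of the free two-body motion
(`pairHits_of_fresh_collision`: `PairHits ε q u` and `pairHitTime ε q u = t − a`, by the equivariance of the hitting
time under free flight and its vanishing at an incoming contact, `HardSphereBilliard`), and by the glue of pieces 4 and
6: under the isolation hypotheses of `stub_kinematicAssembly_isolatedPair`, the increment `w(vᵢ(Δ)) + w(vⱼ(Δ)) − w(vᵢ) −
w(vⱼ)` of a pair IS the static pair functional `φ(xᵢ − xⱼ)` of `stub_kinematicAssembly_mainTerm`
(`isolatedPair_increment_eq`).

References: Gallagher–Saint-Raymond–Texier 2013, §4.1 (Def. 4.1.2); Cercignani–Illner–Pulvirenti 1994, §2.2, §4.2.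
-/

noncomputable section

open MeasureTheory ProbabilityTheory Set Filter Topology
open scoped ENNReal BigOperators InnerProductSpace
open Literature.Analysis.FluidPDE Literature.MathematicalPhysics.KineticTheory

namespace Summit.AtomisticToContinuum.HydrodynamicLimit.Theorems.EnskogCompensator

section Trajectory

variable {d : Type*} [Fintype d] {N : ℕ} {ε : ℝ} {γ : ℝ → Config N d (EuclideanSpace ℝ d)}

/-- **The fresh pair hits at the first hitting time of its free two-body motion**: under the hypotheses of
`fresh_collision`, `PairHits ε q u` and `pairHitTime ε q u = t − a` for `q = xᵢ(a) − xⱼ(a)`,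
`u = vᵢ(a) − vⱼ(a)` (the hitting time is equivariant under free flight and vanishes at an incoming
contact). [cite: CIP1994, §4.2] -/
theorem pairHits_of_fresh_collision (h : IsHardSphereTrajectory (Euclidean.geometry d) ε N γ) {a t : ℝ}
    (hat : a < t) {i j : Fin N} (hij : i ≠ j) (hc : γ t ∈ contactSet (Euclidean.geometry d) N ε i j)
    (hi : ∀ s ∈ Ioo a t, ¬ Participates (Euclidean.geometry d) ε (γ s) i)
    (hj : ∀ s ∈ Ioo a t, ¬ Participates (Euclidean.geometry d) ε (γ s) j) :
    PairHits ε ((γ a i).1 - (γ a j).1) ((γ a i).2 - (γ a j).2) ∧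
      pairHitTime ε ((γ a i).1 - (γ a j).1) ((γ a i).2 - (γ a j).2) = t - a := by
  obtain ⟨hnorm, hin, -, -⟩ := fresh_collision h hat hij hc hi hj
  set q := (γ a i).1 - (γ a j).1 with hq
  set u := (γ a i).2 - (γ a j).2 with hu
  set nv := q + (t - a) • u with hnv
  have hε : 0 ≤ ε := hnorm ▸ norm_nonneg _
  have hu0 : u ≠ 0 := by
    rintro h0
    rw [h0, inner_zero_right] at hin
    exact lt_irrefl _ hin
  -- at the contact point the pair hits, with hitting time `0`
  have hhits : PairHits ε nv u := ⟨hin, by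
    simp only [pairDisc, hnorm, sub_self, mul_zero, sub_zero]; positivity⟩
  have h0 : pairHitTime ε nv u = 0 := (pairHitTime_eq_zero_iff hε hhits).2 hnorm
  have hback : q = nv + (-(t - a)) • u := by rw [hnv, neg_smul, add_neg_cancel_right]
  refine ⟨?_, ?_⟩
  · rw [hback]
    exact hhits.add_smul (by rw [h0]; linarith)
  · rw [hback, pairHitTime_add_smul ε nv u hu0, h0]
    ring

end Trajectory

/-! ## The registered sub-goal: the whole-cell Euclidean flow of the line -/

/-- **Registered sub-goal `stub_kinematicAssembly_freshPair`** (piece of stub `stub_kinematicAssembly`, S2d,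
of the line `enskog-compensator-martingale`): along the whole-cell hard-sphere flow of a good initial datum
`z`, if the spheres `i ≠ j` are in contact at time `t > 0` and neither took part in a collision at the
times of `(0, t)`, then with `q = xᵢ − xⱼ`, `u = vᵢ − vⱼ` (initial relative data) and `n = q + t u`:
`‖n‖ = σ`, `⟪n, u⟫ < 0`, the time-`t` states are `(xᵢ + t vᵢ, (reflectVel n (vᵢ, vⱼ)).1)` and
`(xⱼ + t vⱼ, (reflectVel n (vᵢ, vⱼ)).2)` (so the jump of `w(vᵢ) + w(vⱼ)` is the two-body jump), the free
two-body motion hits with first hitting time exactly `t` (`PairHits σ q u`, `pairHitTime σ q u = t`), and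
`q = σ ω − t u` for an incoming unit direction `ω` (`q` lies in the collision cylinder of the slab).
[cite: GST2013, §4.1 Def. 4.1.2] -/
theorem stub_kinematicAssembly_freshPair : ∀ (σ : ℝ) (n : ℕ) (Ψ : Flows σ) (z : Cell n), z ∈ (Ψ n).good →
    ∀ (i j : Fin n) (t : ℝ), i ≠ j → 0 < t →
      (Ψ n).flow t z ∈ contactSet (Euclidean.geometry (Fin 3)) n σ i j →
      (∀ s ∈ Set.Ioo 0 t, ¬ Participates (Euclidean.geometry (Fin 3)) σ ((Ψ n).flow s z) i) →
      (∀ s ∈ Set.Ioo 0 t, ¬ Participates (Euclidean.geometry (Fin 3)) σ ((Ψ n).flow s z) j) →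
        ‖((z i).1 - (z j).1) + t • ((z i).2 - (z j).2)‖ = σ ∧
        inner ℝ (((z i).1 - (z j).1) + t • ((z i).2 - (z j).2)) ((z i).2 - (z j).2) < 0 ∧
        (Ψ n).flow t z i = ((z i).1 + t • (z i).2,
          (reflectVel (((z i).1 - (z j).1) + t • ((z i).2 - (z j).2)) ((z i).2, (z j).2)).1) ∧
        (Ψ n).flow t z j = ((z j).1 + t • (z j).2,
          (reflectVel (((z i).1 - (z j).1) + t • ((z i).2 - (z j).2)) ((z i).2, (z j).2)).2) ∧
        PairHits σ ((z i).1 - (z j).1) ((z i).2 - (z j).2) ∧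
        pairHitTime σ ((z i).1 - (z j).1) ((z i).2 - (z j).2) = t ∧
        (∃ ω : Metric.sphere (0 : V3) 1, inner ℝ (ω : V3) ((z i).2 - (z j).2) < 0 ∧
          (z i).1 - (z j).1 = σ • (ω : V3) - t • ((z i).2 - (z j).2)) ∧
        ‖(z i).1 - (z j).1‖ ≤ σ + t * ‖(z i).2 - (z j).2‖ := by
  intro σ n Ψ z hz i j t hij ht hc hi hj
  have htraj := (Ψ n).isTrajectory z hz
  have h0 : (Ψ n).flow 0 z = z := (Ψ n).flow_zero z hz
  have h1 := fresh_collision htraj ht hij hc hi hj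
  have h2 := pairHits_of_fresh_collision htraj ht hij hc hi hj
  have h3 := mem_cylinder_of_fresh_collision htraj ht hij hc hi hj
  simp only [h0, sub_zero] at h1 h2 h3
  exact ⟨h1.1, h1.2.1, h1.2.2.1, h1.2.2.2, h2.1, h2.2, h3.1, h3.2⟩


/-! ## Gluing pieces 4 and 6: the increment of an isolated pair is the static pair functional -/

/-- **The increment of an isolated pair is the static pair functional** (pure bookkeeping): if `φ` takes the
two-body jump of `w` on the collision cylinder of the slab and vanishes off it (the clauses of
`stub_kinematicAssembly_mainTerm`), and the pair obeys the dichotomy of `stub_kinematicAssembly_isolatedPair`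
(velocities unchanged and `q ∉ Cyl`, or `q = σ ω − t u ∈ Cyl` with reflected velocities), then
`w(vᵢ') + w(vⱼ') − w(vᵢ) − w(vⱼ) = φ(xᵢ − xⱼ)`. [folklore] -/
theorem increment_eq_pairFunctional {σ Δ : ℝ} {w φ : V3 → ℝ} {xi xj vi vj vi' vj' : V3}
    (hon : ∀ (ω : Metric.sphere (0 : V3) 1) (t : ℝ), t ∈ Set.Ioc 0 Δ → inner ℝ (ω : V3) (vi - vj) < 0 →
      φ (σ • (ω : V3) - t • (vi - vj)) =
        w (reflectVel (σ • (ω : V3)) (vi, vj)).1 + w (reflectVel (σ • (ω : V3)) (vi, vj)).2 - w vi - w vj)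
    (hoff : ∀ q, (¬ ∃ (ω : Metric.sphere (0 : V3) 1) (t : ℝ), t ∈ Set.Ioc 0 Δ ∧ inner ℝ (ω : V3) (vi - vj) < 0 ∧
      q = σ • (ω : V3) - t • (vi - vj)) → φ q = 0)
    (hdich : (vi' = vi ∧ vj' = vj ∧
        ¬ ∃ (ω : Metric.sphere (0 : V3) 1) (t : ℝ), t ∈ Set.Ioc 0 Δ ∧ inner ℝ (ω : V3) (vi - vj) < 0 ∧
          xi - xj = σ • (ω : V3) - t • (vi - vj)) ∨
      (∃ (ω : Metric.sphere (0 : V3) 1) (t : ℝ), t ∈ Set.Ioc 0 Δ ∧ inner ℝ (ω : V3) (vi - vj) < 0 ∧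
        xi - xj = σ • (ω : V3) - t • (vi - vj) ∧
        vi' = (reflectVel (σ • (ω : V3)) (vi, vj)).1 ∧ vj' = (reflectVel (σ • (ω : V3)) (vi, vj)).2)) :
    w vi' + w vj' - w vi - w vj = φ (xi - xj) := by
  rcases hdich with ⟨hvi, hvj, hno⟩ | ⟨ω, t, ht, hωu, hq, hvi, hvj⟩
  · rw [hvi, hvj, hoff _ hno]; ring
  · rw [hq, hon ω t ht hωu, hvi, hvj]

/-- **Isolated pairs of the whole-cell flow contribute exactly the static pair functional** (pieces 4 and 6 glued):
under the isolation hypotheses of `stub_kinematicAssembly_isolatedPair` and for any `φ` with the on/off-cylinder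
clauses of `stub_kinematicAssembly_mainTerm` for the pair `((z i).2, (z j).2)`,
`w(vᵢ(Δ)) + w(vⱼ(Δ)) − w(vᵢ) − w(vⱼ) = φ(xᵢ − xⱼ)`. [cite: CIP1994, §4.2] -/
theorem isolatedPair_increment_eq {σ : ℝ} {n : ℕ} (Ψ : Flows σ) {z : Cell n} (hz : z ∈ (Ψ n).good) (hσ : 0 < σ)
    {i j : Fin n} {Δ : ℝ} (hij : i ≠ j) (hΔ : 0 < Δ)
    (hi : ∀ s ∈ Set.Ioc 0 Δ, ∀ k, Collide (Euclidean.geometry (Fin 3)) σ ((Ψ n).flow s z) i k → k = j)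
    (hj : ∀ s ∈ Set.Ioc 0 Δ, ∀ k, Collide (Euclidean.geometry (Fin 3)) σ ((Ψ n).flow s z) j k → k = i)
    {w φ : V3 → ℝ}
    (hon : ∀ (ω : Metric.sphere (0 : V3) 1) (t : ℝ), t ∈ Set.Ioc 0 Δ → inner ℝ (ω : V3) ((z i).2 - (z j).2) < 0 →
      φ (σ • (ω : V3) - t • ((z i).2 - (z j).2)) =
        w (reflectVel (σ • (ω : V3)) ((z i).2, (z j).2)).1 + w (reflectVel (σ • (ω : V3)) ((z i).2, (z j).2)).2 -
          w (z i).2 - w (z j).2)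
    (hoff : ∀ q, (¬ ∃ (ω : Metric.sphere (0 : V3) 1) (t : ℝ), t ∈ Set.Ioc 0 Δ ∧
      inner ℝ (ω : V3) ((z i).2 - (z j).2) < 0 ∧ q = σ • (ω : V3) - t • ((z i).2 - (z j).2)) → φ q = 0) :
    w ((Ψ n).flow Δ z i).2 + w ((Ψ n).flow Δ z j).2 - w (z i).2 - w (z j).2 = φ ((z i).1 - (z j).1) :=
  increment_eq_pairFunctional hon hoff (stub_kinematicAssembly_isolatedPair σ n Ψ z hz hσ i j Δ hij hΔ hi hj)

end Summit.AtomisticToContinuum.HydrodynamicLimit.Theorems.EnskogCompensator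

end
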